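import Mathlib.Analysis.SpecialFunctions.SmoothTransition
import Mathlib.MeasureTheory.Integral.IntervalIntegral.FundThmCalculus
import Literature.Analysis.FluidPDE.ClassicalSolution
import Literature.Analysis.FunctionSpaces.SmoothParametricIntegral
import HarnessLib

/-!
# The time primitive `∫_{c}^{t} g(s, x) ds` of a jointly smooth field on an open time interval

Analysis/FluidPDE support file. For a field `g : ℝ → X → F` jointly smooth on an OPEN slab
`(a, b) × X` (`IsSmoothSpaceTimeOn (Ioo a b) g`, i.e. `C^∞` within `Ioo a b ×ˢ univ`) and a base
time `c ∈ (a, b)`, the time primitive `(t, x) ↦ ∫ s in c..t, g s x` is again jointly smooth on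
the slab, and `∂ₜ ∫_c^t g(s,x) ds = g(t,x)` (Evans, *PDE*, App. C.; Hörmander, *ALPDO I*,
Thm. 1.1.9 — differentiation under the integral sign — combined with the fundamental theorem of
calculus). This is the regularity behind time-dependent profiles defined through
`∫₀ᵗ (…)(s, x) ds`, e.g. W. S. Ożański, arXiv:1709.00602v4, (4.14) `h²₂,ₜ = f₂² - 2tδφ₂ +
∫₀ᵗ v₂·F[v₁,h₁,ₛ] ds` and (4.16) `(qᵏᵢ,ₜ)² = fᵢ² - 2tδφᵢ - ∫₀ᵗ aᵢᵏ(s) vᵢ·(…) ds` ("all terms on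
the right-hand side of (4.16) are smooth", §4.1), where the integrands are smooth only on an
open time interval.

* `IsSmoothSpaceTimeOn.primitive` — joint smoothness of the primitive on `Ioo a b`. Proof:
  smoothness is local; near `(t₀, x₀)` multiply `g` by a smooth time cut-off `χ` equal to `1`
  on a neighbourhood of the segment between `c` and `t₀` and supported inside `(a, b)`, so that
  `χg` is smooth on all of `ℝ × X`; substitute `s = c + σ(t - c)` to rewrite
  `∫_c^t χg = (t - c) ∫₀¹ (χg)(c + σ(t - c), x) dσ`, a parametric integral over the FIXED
  interval `[0,1]` of a globally smooth integrand, smooth in `(t, x)` by the tree's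
  `Literature.Analysis.FunctionSpaces.contDiff_parametric_intervalIntegral`.
* `IsSmoothSpaceTimeOn.hasDerivAt_primitive` — `∂ₜ ∫_c^t g(s,x) ds = g(t,x)` for `t ∈ (a,b)`
  (Mathlib `intervalIntegral.integral_hasDerivAt_right`).

## References

* L. C. Evans, *Partial Differential Equations*, 2nd ed., App. C (calculus facts).
  [`Evans2010`]
* W. S. Ożański, arXiv:1709.00602v4, §4.1 (4.14), (4.16). [`Ozanski2017NSISingular`]
-/

noncomputable section

open Set Function Filter Topology MeasureTheory intervalIntegral
open scoped ContDiff

namespace Literature.Analysis.FluidPDE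

variable {X : Type*} [NormedAddCommGroup X] [NormedSpace ℝ X] [FiniteDimensional ℝ X]
variable {F : Type*} [NormedAddCommGroup F] [NormedSpace ℝ F] [CompleteSpace F]

/-! ### A smooth time cut-off -/

/-- The smooth plateau `χ(s) = ρ((s - a - κ)/κ) ρ((b - κ - s)/κ)`, `ρ = smoothTransition`: smooth,
`= 1` on `[a + 2κ, b - 2κ]`, `= 0` off `(a + κ, b - κ)`. [folklore] -/
theorem exists_smooth_plateau (a b κ : ℝ) (hκ : 0 < κ) :
    ∃ χ : ℝ → ℝ, ContDiff ℝ ∞ χ ∧ (∀ s ∈ Icc (a + 2 * κ) (b - 2 * κ), χ s = 1) ∧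
      (∀ s, s ≤ a + κ → χ s = 0) ∧ (∀ s, b - κ ≤ s → χ s = 0) := by
  refine ⟨fun s =>
      Real.smoothTransition ((s - a - κ) / κ) * Real.smoothTransition ((b - κ - s) / κ),
    ?_, fun s hs => ?_, fun s hs => ?_, fun s hs => ?_⟩
  · exact (Real.smoothTransition.contDiff.comp (((contDiff_id.sub contDiff_const).sub
      contDiff_const).div_const κ)).mul
      (Real.smoothTransition.contDiff.comp ((contDiff_const.sub contDiff_id).div_const κ))
  · dsimp only
    rw [Real.smoothTransition.one_of_one_le, Real.smoothTransition.one_of_one_le, mul_one]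
    · rw [le_div_iff₀ hκ]; linarith [hs.2]
    · rw [le_div_iff₀ hκ]; linarith [hs.1]
  · dsimp only
    rw [Real.smoothTransition.zero_of_nonpos, zero_mul]
    exact div_nonpos_of_nonpos_of_nonneg (by linarith) hκ.le
  · dsimp only
    rw [Real.smoothTransition.zero_of_nonpos (x := (b - κ - s) / κ), mul_zero]
    exact div_nonpos_of_nonpos_of_nonneg (by linarith) hκ.le

/-! ### The primitive -/

omit [FiniteDimensional ℝ X] [CompleteSpace F] in
/-- A jointly smooth field on an open slab, multiplied by a smooth time cut-off supported inside
the time interval, is smooth on all of `ℝ × X`. [folklore] -/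
theorem IsSmoothSpaceTimeOn.contDiff_cutoff_smul {a b : ℝ} {g : ℝ → X → F}
    (hg : IsSmoothSpaceTimeOn (Ioo a b) g) {χ : ℝ → ℝ} (hχ : ContDiff ℝ ∞ χ) {κ : ℝ} (hκ : 0 < κ)
    (h0a : ∀ s, s ≤ a + κ → χ s = 0) (h0b : ∀ s, b - κ ≤ s → χ s = 0) :
    ContDiff ℝ ∞ fun p : ℝ × X => χ p.1 • g p.1 p.2 := by
  refine contDiff_iff_contDiffAt.2 fun p => ?_
  by_cases hp : p.1 ∈ Ioo a b
  · have hO : IsOpen (Ioo a b ×ˢ (univ : Set X)) := isOpen_Ioo.prod isOpen_univ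
    have hgp : ContDiffAt ℝ ∞ (uncurry g) p := hg.contDiffAt (hO.mem_nhds ⟨hp, mem_univ _⟩)
    exact ((hχ.comp contDiff_fst).contDiffAt).smul hgp
  · -- near a time outside `(a, b)` the cut-off vanishes identically
    have hz : ∀ᶠ q in 𝓝 p, χ (q : ℝ × X).1 = 0 := by
      rw [mem_Ioo, not_and_or, not_lt, not_lt] at hp
      rcases hp with hp | hp
      · have hO : IsOpen {q : ℝ × X | q.1 < a + κ} := isOpen_lt continuous_fst continuous_const
        filter_upwards [hO.mem_nhds (show p.1 < a + κ by linarith)] with q hq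
        exact h0a _ (le_of_lt hq)
      · have hO : IsOpen {q : ℝ × X | b - κ < q.1} := isOpen_lt continuous_const continuous_fst
        filter_upwards [hO.mem_nhds (show b - κ < p.1 by linarith)] with q hq
        exact h0b _ (le_of_lt hq)
    have he : (fun q : ℝ × X => χ q.1 • g q.1 q.2) =ᶠ[𝓝 p] fun _ => 0 :=
      hz.mono fun q hq => by
        show χ q.1 • g q.1 q.2 = 0
        rw [hq, zero_smul]
    exact contDiffAt_const.congr_of_eventuallyEq he

omit [FiniteDimensional ℝ X] [CompleteSpace F] in
/-- The substitution `s = c + σ(t - c)`: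
`(t - c) • ∫₀¹ G(c + σ(t - c)) dσ = ∫_c^t G(s) ds`. [folklore] -/
theorem smul_integral_comp_affine (G : ℝ → F) (c t : ℝ) :
    (t - c) • ∫ σ in (0 : ℝ)..1, G ((t - c) * σ + c) = ∫ s in c..t, G s := by
  rw [intervalIntegral.smul_integral_comp_mul_add]
  simp

omit [CompleteSpace F] in
/-- **The time primitive of a jointly smooth field is jointly smooth** on an open slab: for
`g` smooth on `(a, b) × X` and `c ∈ (a, b)`, `(t, x) ↦ ∫ s in c..t, g s x` is smooth on
`(a, b) × X` (Evans, App. C; differentiation under the integral sign after the substitution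
`s = c + σ(t - c)`). [cite: Evans2010, App. C] -/
theorem IsSmoothSpaceTimeOn.primitive {a b c : ℝ} {g : ℝ → X → F}
    (hg : IsSmoothSpaceTimeOn (Ioo a b) g) (hc : c ∈ Ioo a b) :
    IsSmoothSpaceTimeOn (Ioo a b) fun t x => ∫ s in c..t, g s x := by
  rintro ⟨t₀, x₀⟩ ⟨ht₀, -⟩
  -- margins
  set m : ℝ := min (min (t₀ - a) (b - t₀)) (min (c - a) (b - c)) with hm
  have hm0 : 0 < m := lt_min (lt_min (by linarith [ht₀.1]) (by linarith [ht₀.2]))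
    (lt_min (by linarith [hc.1]) (by linarith [hc.2]))
  set κ : ℝ := m / 3 with hκ
  have hκ0 : 0 < κ := by positivity
  have hma : m ≤ t₀ - a := (min_le_left _ _).trans (min_le_left _ _)
  have hmb : m ≤ b - t₀ := (min_le_left _ _).trans (min_le_right _ _)
  have hmc : m ≤ c - a := (min_le_right _ _).trans (min_le_left _ _)
  have hmd : m ≤ b - c := (min_le_right _ _).trans (min_le_right _ _)
  obtain ⟨χ, hχ, hχ1, hχa, hχb⟩ := exists_smooth_plateau a b κ hκ0
  -- the globally smooth cut-off field and its parametric integral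
  have hG : ContDiff ℝ ∞ fun p : ℝ × X => χ p.1 • g p.1 p.2 :=
    hg.contDiff_cutoff_smul hχ hκ0 hχa hχb
  have hA : ContDiff ℝ ∞ fun r : ℝ × (ℝ × X) => (((r.2.1 - c) * r.1 + c, r.2.2) : ℝ × X) :=
    ((((contDiff_fst.comp contDiff_snd).sub contDiff_const).mul contDiff_fst).add
      contDiff_const).prodMk (contDiff_snd.comp contDiff_snd)
  have hI : ContDiff ℝ ∞ fun p : ℝ × X =>
      ∫ σ in (0 : ℝ)..1, χ ((p.1 - c) * σ + c) • g ((p.1 - c) * σ + c) p.2 :=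
    Literature.Analysis.FunctionSpaces.contDiff_parametric_intervalIntegral_comp hG hA 0 1
  have hR : ContDiff ℝ ∞ fun p : ℝ × X =>
      (p.1 - c) • ∫ σ in (0 : ℝ)..1, χ ((p.1 - c) * σ + c) • g ((p.1 - c) * σ + c) p.2 :=
    (contDiff_fst.sub contDiff_const).smul hI
  -- on the neighbourhood `J₀ × X` of `(t₀, x₀)` the primitive agrees with the cut-off one
  set J₀ : Set ℝ := Ioo (t₀ - κ) (t₀ + κ) with hJ₀
  have hχseg : ∀ t ∈ J₀, ∀ s ∈ uIcc c t, χ s = 1 := by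
    intro t ht s hs
    apply hχ1
    rcases le_total c t with hct | hct
    · rw [uIcc_of_le hct] at hs
      constructor <;> nlinarith [hs.1, hs.2, ht.1, ht.2]
    · rw [uIcc_of_ge hct] at hs
      constructor <;> nlinarith [hs.1, hs.2, ht.1, ht.2]
  have heq : ∀ p : ℝ × X, p.1 ∈ J₀ →
      (p.1 - c) • ∫ σ in (0 : ℝ)..1, χ ((p.1 - c) * σ + c) • g ((p.1 - c) * σ + c) p.2 =
        ∫ s in c..p.1, g s p.2 := by
    intro p hp
    rw [smul_integral_comp_affine (fun s => χ s • g s p.2) c p.1]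
    refine intervalIntegral.integral_congr fun s hs => ?_
    simp only [hχseg p.1 hp s hs, one_smul]
  have hN : J₀ ×ˢ (univ : Set X) ∈ 𝓝 (t₀, x₀) :=
    (isOpen_Ioo.prod isOpen_univ).mem_nhds ⟨⟨by linarith, by linarith⟩, mem_univ _⟩
  have hev : (uncurry fun t x => ∫ s in c..t, g s x) =ᶠ[𝓝 (t₀, x₀)] fun p : ℝ × X =>
      (p.1 - c) • ∫ σ in (0 : ℝ)..1, χ ((p.1 - c) * σ + c) • g ((p.1 - c) * σ + c) p.2 := by
    filter_upwards [hN] with p hp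
    exact (heq p hp.1).symm
  exact (hR.contDiffAt.congr_of_eventuallyEq hev).contDiffWithinAt

omit [FiniteDimensional ℝ X] in
/-- **`∂ₜ ∫_c^t g(s, x) ds = g(t, x)`** for `t ∈ (a, b)` and a field jointly smooth (indeed
jointly continuous suffices) on `(a, b) × X` (the fundamental theorem of calculus, Mathlib
`intervalIntegral.integral_hasDerivAt_right`). [folklore] -/
theorem IsSmoothSpaceTimeOn.hasDerivAt_primitive {a b c : ℝ} {g : ℝ → X → F}
    (hg : IsSmoothSpaceTimeOn (Ioo a b) g) (hc : c ∈ Ioo a b) {t : ℝ} (ht : t ∈ Ioo a b)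
    (x : X) : HasDerivAt (fun u => ∫ s in c..u, g s x) (g t x) t := by
  have hcont : ContinuousOn (fun s => g s x) (Ioo a b) := by
    have h1 : ContinuousOn (uncurry g) (Ioo a b ×ˢ univ) := hg.continuousOn
    have h2 : Continuous fun s : ℝ => ((s, x) : ℝ × X) := by fun_prop
    exact (h1.comp h2.continuousOn fun s hs => ⟨hs, mem_univ _⟩)
  have hsub : uIcc c t ⊆ Ioo a b := by
    rcases le_total c t with hct | hct
    · rw [uIcc_of_le hct]; exact fun s hs => ⟨lt_of_lt_of_le hc.1 hs.1, lt_of_le_of_lt hs.2 ht.2⟩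
    · rw [uIcc_of_ge hct]; exact fun s hs => ⟨lt_of_lt_of_le ht.1 hs.1, lt_of_le_of_lt hs.2 hc.2⟩
  exact intervalIntegral.integral_hasDerivAt_right ((hcont.mono hsub).intervalIntegrable)
    (hcont.stronglyMeasurableAtFilter isOpen_Ioo _ ht)
    (hcont.continuousAt (Ioo_mem_nhds ht.1 ht.2))

omit [FiniteDimensional ℝ X] in
/-- `deriv` form of `IsSmoothSpaceTimeOn.hasDerivAt_primitive`. [folklore] -/
theorem IsSmoothSpaceTimeOn.deriv_primitive {a b c : ℝ} {g : ℝ → X → F}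
    (hg : IsSmoothSpaceTimeOn (Ioo a b) g) (hc : c ∈ Ioo a b) {t : ℝ} (ht : t ∈ Ioo a b)
    (x : X) : deriv (fun u => ∫ s in c..u, g s x) t = g t x :=
  (hg.hasDerivAt_primitive hc ht x).deriv

end Literature.Analysis.FluidPDE
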